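import Summits.QuantumFields.YangMills.Theorems.AlphaInputsT3ACv3HLiftWindowKnit
import HarnessLib

/-!
# `AlphaInputsT3ACv3ZfullFloor` — the (FL) `hLift` window row is a FLOOR ROW: **`Z_full ≥ 3` FOR EVERY RECORD**, hence
# `avgWindowFactor L ≤ 8·B₃·Z_full·ε_FL` follows from `avgWindowFactor L ∕ (24·ε_FL) ≤ B₃` alone — lane `pub-balaban3d` ∕ cell `ym3-torus`, width seat
# `ym-ust-19936-w6` (g0)

WHY (★★OWNER ym3-torus-plan g25 RULING (FL-SMALL) (c′) 2026-08-28T03:29:46Z: «every (FL) knit carries `(hε : ε′ ≤ ε_FL)` …; `ε′ ≤ ε_FL` is the ARITHMETIC ROW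
`B₃·Z_full ≥ 19L²∕ε_FL`, met by choosing `B₀(L)` at the top of `hrows`»; ★w2-19936 g3 2026-08-28T04:59:36Z: after ✓ `flConjunct_of_clauses` «EXACTLY TWO record rows
left: `(10^27+1)·L² ≤ B₃` (floor) and `10^34·L·avgWindowFactor L ≤ 8·B₃·Z_full` (window row)» — asking where the window row belongs).  The torus constant
`Z_full = Z′(κ₁∕M₁)` of [Balaban1985UV3] (45)–(46) (`Primitives.AlphaConsts.Zfull`, the full-rate sum `(2∕x)·24·(48∕(x∕2)³)·e^{x∕4}∕(1 − e^{−x∕4}) =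
18432·x⁻⁴·e^{x∕4}∕(1 − e^{−x∕4})`, `x = κ₁∕M₁`) is bounded BELOW by an absolute constant: `0 < 1 − e^{−x∕4} ≤ 1` and `e^{x∕4} ≥ (x∕4)⁴∕4!` make every power
of `x` cancel, `Z_full ≥ 18432∕(4⁴·24) = 3`.
So the window row is NOT a constraint on the record NODE O exhibits (no `κ₁`∕`M₁` condition, no extra conjunct «at any tolerance») and NOT a new (FL) obligation: it is
discharged by the (FL) supplier's floor `B₀(L)` exactly like `B_L·L² ≤ B₃`.  THIS FILE proves the floor and re-exports ★w2 g3's two knit theorems with the two record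
rows replaced by ONE floor hypothesis `max (max (B_big+1) 257 · L²) (avgWindowFactor L ∕ (24·ε_FL)) ≤ B₃`.
WHAT (def-free).  §1 `zfullExpr_ge` (the closed-form bound for every `x > 0`), ★ `Zfull_ge : 3 ≤ 𝔠.Zfull` for EVERY `𝔠 : AlphaConsts L N`, `one_le_Zfull`;
§2 `avgWindowFactor_nonneg`, ★ `windowRow_of_floor`, `flRows_of_floor`, `flRows_of_le_of_floor`; §3 ★ `innerFineLiftsT3_of_clauses_floor`, ★★ `flConjunct_of_clauses_floor` (★w2's `innerFineLiftsT3_of_clauses` ∕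
`flConjunct_of_clauses` VERBATIM with `hBB`, `hrow` ⇐ the floor).
HONEST FRAMING.  Elementary real arithmetic on a tree definition plus composition of landed theorems; the big-k clause `hBig` (START + Newton, MAP M22) stays a HYPOTHESIS;
(FL)∕`hLift`, the stub `stub_laneRecordsV3Chi`, the crux `HistoryTailL` and any gap are NOT claimed; count-neutral helper toward R3 2′∕2′χ (items 19936∕19935,
`--supports stmt-QuantumFields-19936`); registry untouched.  YM₃ on the three-torus is rung R3 of the programme, not the Clay problem: nothing here is about d = 4,
infinite volume, or a mass gap.

References: T. Bałaban, Commun. Math. Phys. 102 (1985) 255–275 [Balaban1985UV3] ((7) p.257, (40)–(42) p.266, (45)–(46) p.267); Commun. Math. Phys. 102 (1985)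
277–309 [Balaban1985Variational] (Thm 1 (8) p.279, (11)–(14) pp.279–280).
-/

set_option autoImplicit false

noncomputable section

namespace Summit.QuantumFields.YangMills.Theorems.HLiftWindowKnit

open scoped Matrix.Norms.L2Operator
open Literature.MathematicalPhysics.QuantumFieldTheory.Balaban1983to89
open Literature.MathematicalPhysics.QuantumFieldTheory.Balaban1983to89.T3ContinuumYM3Torus
open Literature.MathematicalPhysics.QuantumFieldTheory.Balaban1983to89.T3UnitLawDensityEML (ℰp)
open Literature.MathematicalPhysics.QuantumFieldTheory.Balaban1983to89.T3UnitScaleTilt (θBal)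
open Literature.MathematicalPhysics.QuantumFieldTheory.Balaban1983to89.B10Eq38TorusDomains (plaqsIn)
open Literature.MathematicalPhysics.QuantumFieldTheory.Balaban1983to89.B10Eq42TorusConstraint (bondsIn)
open Literature.MathematicalPhysics.QuantumFieldTheory.Balaban1985CMP102.Setting
open Summit.QuantumFields.Balaban3D.Carriers
open Summit.QuantumFields.Balaban3D.Proofs.Primitives (AlphaConsts)

/-! ## §1 The universal floor of the torus constant `Z_full` -/

/-- **THE CLOSED-FORM BOUND**: for every `x > 0`, `3 ≤ (2∕x)·(24·(48∕(x∕2)³·e^{x∕2∕2}∕(1 − e^{−(x∕2∕2)}))·1)` — with `t := x∕4`, `0 < 1 − e^{−t} ≤ 1` gives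
`eᵗ∕(1 − e^{−t}) ≥ eᵗ ≥ t⁴∕24` (`Real.pow_div_factorial_le_exp`), and `(2∕x)·24·(48∕(x∕2)³)·(x∕4)⁴∕24 = 18432∕6144 = 3`. [cite: Balaban1985UV3, (45)–(46) p.267 (the constant `Z′`; bookkeeping)] -/
theorem zfullExpr_ge {x : ℝ} (hx : 0 < x) :
    (3 : ℝ) ≤ 2 / x * (24 * (48 / (x / 2) ^ 3 * Real.exp (x / 2 / 2) / (1 - Real.exp (-(x / 2 / 2)))) * 1) := by
  set t : ℝ := x / 2 / 2 with ht_def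
  have ht : 0 < t := by rw [ht_def]; positivity
  have hlt : Real.exp (-t) < 1 := Real.exp_lt_one_iff.2 (by linarith)
  have hden : 0 < 1 - Real.exp (-t) := by linarith
  have hden1 : 1 - Real.exp (-t) ≤ 1 := by linarith [Real.exp_pos (-t)]
  have h4 : t ^ 4 / 24 ≤ Real.exp t := by
    have h := Real.pow_div_factorial_le_exp t ht.le 4
    have h24 : ((Nat.factorial 4 : ℕ) : ℝ) = 24 := by norm_num [Nat.factorial]
    rwa [h24] at h
  have hkey : t ^ 4 / 24 ≤ Real.exp t / (1 - Real.exp (-t)) := by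
    rw [le_div_iff₀ hden]
    calc t ^ 4 / 24 * (1 - Real.exp (-t)) ≤ t ^ 4 / 24 * 1 := mul_le_mul_of_nonneg_left hden1 (by positivity)
      _ = t ^ 4 / 24 := by ring
      _ ≤ Real.exp t := h4
  have hx0 : x ≠ 0 := hx.ne'
  have hE : 2 / x * (24 * (48 / (x / 2) ^ 3 * Real.exp t / (1 - Real.exp (-t))) * 1) =
      (2 / x * 24 * (48 / (x / 2) ^ 3)) * (Real.exp t / (1 - Real.exp (-t))) := by
    ring
  rw [hE]
  have hcoef : 0 ≤ 2 / x * 24 * (48 / (x / 2) ^ 3) := by positivity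
  have hval : (2 / x * 24 * (48 / (x / 2) ^ 3)) * (t ^ 4 / 24) = 3 := by
    rw [ht_def]
    field_simp
    ring
  calc (3 : ℝ) = (2 / x * 24 * (48 / (x / 2) ^ 3)) * (t ^ 4 / 24) := hval.symm
    _ ≤ (2 / x * 24 * (48 / (x / 2) ^ 3)) * (Real.exp t / (1 - Real.exp (-t))) := mul_le_mul_of_nonneg_left hkey hcoef

/-- **★ THE UNIVERSAL FLOOR OF `Z_full`**: for EVERY primitive-constants record `𝔠 : AlphaConsts L N`, `3 ≤ 𝔠.Zfull` — only `κ₁ > 0` and `M₁ > 0` are used; the rate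
`x = κ₁∕M₁` cancels. [cite: Balaban1985UV3, (45)–(46) p.267 (the constant `Z′(κ₁∕M₁)`; bookkeeping)] -/
theorem Zfull_ge {L N : ℕ} (𝔠 : AlphaConsts L N) : (3 : ℝ) ≤ 𝔠.Zfull := by
  have hx : 0 < 𝔠.κ₁ / (𝔠.M₁ : ℝ) := div_pos 𝔠.κ₁_pos 𝔠.M₁_pos_real
  have h := zfullExpr_ge hx
  unfold AlphaConsts.Zfull
  exact h

/-- `Z_full ≥ 1` (convenience). [folklore] -/
theorem one_le_Zfull {L N : ℕ} (𝔠 : AlphaConsts L N) : (1 : ℝ) ≤ 𝔠.Zfull :=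
  le_trans (by norm_num) (Zfull_ge 𝔠)

/-! ## §2 The window row from a floor on `B₃` -/

/-- The lane's window factor `L² + 6(5L)²` is non-negative at every `L`. [folklore] -/
theorem avgWindowFactor_nonneg (L : ℕ) : 0 ≤ avgWindowFactor L := by
  unfold avgWindowFactor
  positivity

/-- **★ THE WINDOW ROW FROM THE FLOOR**: `avgWindowFactor L ∕ (24·ε_FL) ≤ B₃` and `0 < ε_FL` give the FL-SMALL (c′) record row
`avgWindowFactor L ≤ 8·B₃·Z_full·ε_FL` (`8·3 = 24`, `Zfull_ge`). [cite: Balaban1985UV3, (7) p.257, (40)–(42) p.266, (45) p.267] -/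
theorem windowRow_of_floor {L N : ℕ} (𝔠 : AlphaConsts L N) {εFL : ℝ} (hε : 0 < εFL)
    (hB : avgWindowFactor L / (24 * εFL) ≤ 𝔠.B₃) :
    avgWindowFactor L ≤ 8 * 𝔠.B₃ * 𝔠.Zfull * εFL := by
  have hZ := Zfull_ge 𝔠
  have hB0 : 0 ≤ 𝔠.B₃ := 𝔠.B₃_pos.le
  have h1 : avgWindowFactor L ≤ 𝔠.B₃ * (24 * εFL) := (div_le_iff₀ (by positivity)).1 hB
  calc avgWindowFactor L ≤ 𝔠.B₃ * (24 * εFL) := h1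
    _ = 8 * 𝔠.B₃ * 3 * εFL := by ring
    _ ≤ 8 * 𝔠.B₃ * 𝔠.Zfull * εFL := by gcongr

/-- **THE TWO RECORD ROWS OF `flConjunct_of_clauses` FROM ONE FLOOR**: `max (B_L·L²) (avgWindowFactor L ∕ (24·ε_FL)) ≤ B₃` gives `B_L·L² ≤ B₃` and the window row.
[cite: Balaban1985UV3, (7) p.257, (45) p.267] -/
theorem flRows_of_floor {L N : ℕ} (𝔠 : AlphaConsts L N) {B_L εFL : ℝ} (hε : 0 < εFL)
    (hB : max (B_L * (L : ℝ) ^ 2) (avgWindowFactor L / (24 * εFL)) ≤ 𝔠.B₃) :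
    B_L * (L : ℝ) ^ 2 ≤ 𝔠.B₃ ∧ avgWindowFactor L ≤ 8 * 𝔠.B₃ * 𝔠.Zfull * εFL :=
  ⟨(le_max_left _ _).trans hB, windowRow_of_floor 𝔠 hε ((le_max_right _ _).trans hB)⟩

/-- The floor is monotone in nothing but itself: any `B₃` above `max (B_L·L²) (avgWindowFactor L ∕ (24·ε_FL))` works, in particular the supplier may take
`B₀(L) := max (B_L·L²) (avgWindowFactor L ∕ (24·ε_FL))` in `hrows` and every `B ≥ B₀(L)` inherits both rows. [folklore] -/
theorem flRows_of_le_of_floor {L N : ℕ} (𝔠 : AlphaConsts L N) {B_L εFL B₀ : ℝ} (hε : 0 < εFL)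
    (hB₀ : max (B_L * (L : ℝ) ^ 2) (avgWindowFactor L / (24 * εFL)) ≤ B₀) (hB : B₀ ≤ 𝔠.B₃) :
    B_L * (L : ℝ) ^ 2 ≤ 𝔠.B₃ ∧ avgWindowFactor L ≤ 8 * 𝔠.B₃ * 𝔠.Zfull * εFL :=
  flRows_of_floor 𝔠 hε (hB₀.trans hB)

/-! ## §3 ★w2 g3's knit theorems with the two record rows replaced by the floor -/

variable {F : T3Family} {𝔠 : AlphaConsts F.L (suGroupModel 2).N} {γ : ℝ} {hγ : 0 < γ} {hγ1 : γ ≤ (min 𝔠.gamma0 1) ^ 2} {K : ℕ}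

variable (F 𝔠 γ hγ hγ1 K) in
/-- **★ (FL) AT THE RECORD'S `B₃` FROM THE BIG-k CLAUSE AND ONE FLOOR**: `innerFineLiftsT3_of_clauses` with `hBB`, `hrow` supplied by `flRows_of_floor`.
[cite: Balaban1985Variational, Thm 1 (8) p.279, (11)–(14) pp.279–280; Balaban1985UV3, (7) p.257, (40)+(42) p.266, (45) p.267] -/
theorem innerFineLiftsT3_of_clauses_floor {Bbig εFL : ℝ} (hε : 0 < εFL)
    (hB₃ : max (max (Bbig + 1) 257 * (F.L : ℝ) ^ 2) (avgWindowFactor F.L / (24 * εFL)) ≤ 𝔠.B₃)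
    (hBig : ∀ (k : ℕ), k + 1 ≤ K → 16 ≤ (F.P K).L ^ k → 4 * (F.P K).L ^ k ≤ (F.P K).sitesPerDir 0 → ∀ (h : Hist (F.P K) (k + 1)),
      Hist.Admissible 𝔠.lane.carrier.M₁ (rcolOf (T3Scales F γ hγ (hγ1.trans (sq_min_one_le _ 𝔠.gamma0_pos)) K) 𝔠.lane.carrier) (k + 1) h →
      h ≠ Hist.triv (F.P K) (k + 1) → ∀ (V : GaugeField (F.P K) k (Matrix.specialUnitaryGroup (Fin 2) ℂ)) (ε' : ℝ), 0 < ε' → ε' ≤ εFL →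
        (∀ Q : Plaq (F.P K) k, Q ∈ plaqsIn k (Omega 𝔠.lane.carrier.M₁
            (rcolOf (T3Scales F γ hγ (hγ1.trans (sq_min_one_le _ 𝔠.gamma0_pos)) K) 𝔠.lane.carrier) (k + 1) h (k + 1)) →
          GaugeGroup.dist1 (GaugeField.plaqHol V Q) ≤ ε') →
        ∃ U : GaugeField (F.P K) 0 (Matrix.specialUnitaryGroup (Fin 2) ℂ),
          (∀ b : PBond (F.P K) k, b ∈ bondsIn k (Omega 𝔠.lane.carrier.M₁
              (rcolOf (T3Scales F γ hγ (hγ1.trans (sq_min_one_le _ 𝔠.gamma0_pos)) K) 𝔠.lane.carrier) (k + 1) h (k + 1)) →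
            Averaging.iter (fun i => BlockAveraging.blockAvg (P := F.P K) (j := i) ℰp) k U b = V b) ∧
          ∀ q : Plaq (F.P K) 0, q ∈ plaqsIn 0 (Omega 𝔠.lane.carrier.M₁
              (rcolOf (T3Scales F γ hγ (hγ1.trans (sq_min_one_le _ 𝔠.gamma0_pos)) K) 𝔠.lane.carrier) (k + 1) h (k + 1)) →
            GaugeGroup.dist1 (GaugeField.plaqHol U q) ≤ Bbig * (ε' / (((F.P K).L : ℝ) ^ k) ^ 2)) :
    AlphaInputsT3AC.InnerFineLiftsT3 F 𝔠 γ hγ hγ1 K 𝔠.B₃ :=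
  innerFineLiftsT3_of_clauses F 𝔠 γ hγ hγ1 K (flRows_of_floor 𝔠 hε hB₃).1 (flRows_of_floor 𝔠 hε hB₃).2 hBig

variable (F 𝔠) in
/-- **★★ THE PER-FAMILY (FL) CONJUNCT OF THE ONE-SUPPLIER THEOREMS FROM THE BIG-k CLAUSE AND ONE FLOOR**: `flConjunct_of_clauses` with its two record rows
`max (B_big+1) 257 · L² ≤ B₃` and `avgWindowFactor L ≤ 8·B₃·Z_full·ε_FL` supplied by `flRows_of_floor` from the single floor hypothesis
`max (max (B_big+1) 257 · L²) (avgWindowFactor L ∕ (24·ε_FL)) ≤ B₃` — the conclusion is the per-family (FL) conjunct of ★★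
`pinnedPartsT3ACRecFLChi_of_thm1_regionalLiftsWindow_rows` ∕ `…RecFL_…` VERBATIM, so the (FL) supplier's `B₀(L)` in `hrows` is that floor and nothing else.
[cite: Balaban1985Variational, Thm 1 (8) p.279, (11)–(14) pp.279–280; Balaban1985UV3, (7) p.257, (45)+(47) p.267] -/
theorem flConjunct_of_clauses_floor {Bbig εFL : ℝ} (hε : 0 < εFL)
    (hB₃ : max (max (Bbig + 1) 257 * (F.L : ℝ) ^ 2) (avgWindowFactor F.L / (24 * εFL)) ≤ 𝔠.B₃)
    (hBig : ∀ (γ : ℝ) (hγ : 0 < γ) (hγ1 : γ ≤ (min 𝔠.gamma0 1) ^ 2) (K : ℕ),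
      ∀ (k : ℕ), k + 1 ≤ K → 16 ≤ (F.P K).L ^ k → 4 * (F.P K).L ^ k ≤ (F.P K).sitesPerDir 0 → ∀ (h : Hist (F.P K) (k + 1)),
      Hist.Admissible 𝔠.lane.carrier.M₁ (rcolOf (T3Scales F γ hγ (hγ1.trans (sq_min_one_le _ 𝔠.gamma0_pos)) K) 𝔠.lane.carrier) (k + 1) h →
      h ≠ Hist.triv (F.P K) (k + 1) → ∀ (V : GaugeField (F.P K) k (Matrix.specialUnitaryGroup (Fin 2) ℂ)) (ε' : ℝ), 0 < ε' → ε' ≤ εFL →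
        (∀ Q : Plaq (F.P K) k, Q ∈ plaqsIn k (Omega 𝔠.lane.carrier.M₁
            (rcolOf (T3Scales F γ hγ (hγ1.trans (sq_min_one_le _ 𝔠.gamma0_pos)) K) 𝔠.lane.carrier) (k + 1) h (k + 1)) →
          GaugeGroup.dist1 (GaugeField.plaqHol V Q) ≤ ε') →
        ∃ U : GaugeField (F.P K) 0 (Matrix.specialUnitaryGroup (Fin 2) ℂ),
          (∀ b : PBond (F.P K) k, b ∈ bondsIn k (Omega 𝔠.lane.carrier.M₁
              (rcolOf (T3Scales F γ hγ (hγ1.trans (sq_min_one_le _ 𝔠.gamma0_pos)) K) 𝔠.lane.carrier) (k + 1) h (k + 1)) →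
            Averaging.iter (fun i => BlockAveraging.blockAvg (P := F.P K) (j := i) ℰp) k U b = V b) ∧
          ∀ q : Plaq (F.P K) 0, q ∈ plaqsIn 0 (Omega 𝔠.lane.carrier.M₁
              (rcolOf (T3Scales F γ hγ (hγ1.trans (sq_min_one_le _ 𝔠.gamma0_pos)) K) 𝔠.lane.carrier) (k + 1) h (k + 1)) →
            GaugeGroup.dist1 (GaugeField.plaqHol U q) ≤ Bbig * (ε' / (((F.P K).L : ℝ) ^ k) ^ 2)) :
    ∃ B_L εFL' : ℝ, 1 ≤ B_L ∧ B_L * (F.L : ℝ) ^ 2 ≤ 𝔠.B₃ ∧ avgWindowFactor F.L ≤ 8 * 𝔠.B₃ * 𝔠.Zfull * εFL' ∧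
      ∀ (γ : ℝ) (hγ : 0 < γ) (hγ1 : γ ≤ (min 𝔠.gamma0 1) ^ 2) (K : ℕ),
      ∀ (k : ℕ), k + 1 ≤ K → ∀ (h : Hist (F.P K) (k + 1)),
        Hist.Admissible 𝔠.lane.carrier.M₁ (rcolOf (T3Scales F γ hγ (hγ1.trans (sq_min_one_le _ 𝔠.gamma0_pos)) K) 𝔠.lane.carrier) (k + 1) h →
        h ≠ Hist.triv (F.P K) (k + 1) → ∀ (V : GaugeField (F.P K) k (Matrix.specialUnitaryGroup (Fin 2) ℂ)),
          (∀ Q : Plaq (F.P K) k, Q ∈ plaqsIn k (Omega 𝔠.lane.carrier.M₁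
              (rcolOf (T3Scales F γ hγ (hγ1.trans (sq_min_one_le _ 𝔠.gamma0_pos)) K) 𝔠.lane.carrier) (k + 1) h (k + 1)) →
            GaugeGroup.dist1 (GaugeField.plaqHol V Q) ≤ 2 * (F.L : ℝ) ^ 2 * avgWindowFactor F.L * θBal F.L γ 𝔠.b₀ 𝔠.p₀ (K - k)) →
          2 * (F.L : ℝ) ^ 2 * avgWindowFactor F.L * θBal F.L γ 𝔠.b₀ 𝔠.p₀ (K - k) ≤ εFL' →
          ∃ U : GaugeField (F.P K) 0 (Matrix.specialUnitaryGroup (Fin 2) ℂ),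
            (∀ b : PBond (F.P K) k, b ∈ bondsIn k (Omega 𝔠.lane.carrier.M₁
                (rcolOf (T3Scales F γ hγ (hγ1.trans (sq_min_one_le _ 𝔠.gamma0_pos)) K) 𝔠.lane.carrier) (k + 1) h (k + 1)) →
              Averaging.iter (fun i => BlockAveraging.blockAvg (P := F.P K) (j := i) ℰp) k U b = V b) ∧
            ∀ q : Plaq (F.P K) 0, q ∈ plaqsIn 0 (Omega 𝔠.lane.carrier.M₁
                (rcolOf (T3Scales F γ hγ (hγ1.trans (sq_min_one_le _ 𝔠.gamma0_pos)) K) 𝔠.lane.carrier) (k + 1) h (k + 1)) →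
              GaugeGroup.dist1 (GaugeField.plaqHol U q) <
                B_L * (2 * (F.L : ℝ) ^ 2 * avgWindowFactor F.L * θBal F.L γ 𝔠.b₀ 𝔠.p₀ (K - k)) * (((F.L : ℝ) ^ k)⁻¹) ^ 2 :=
  flConjunct_of_clauses F 𝔠 (flRows_of_floor 𝔠 hε hB₃).1 (flRows_of_floor 𝔠 hε hB₃).2 hBig

end Summit.QuantumFields.YangMills.Theorems.HLiftWindowKnit

end
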